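import Summits.SmoothPoincare4.SmoothPoincare4.Theorems.InformationMetricHadamardAhHadamardFillingStubUniformCone
import Summits.SmoothPoincare4.SmoothPoincare4.Theorems.InformationMetricHadamardAhHadamardFillingStubNormalPairPointwise
import Literature.Geometry.Lorentzian.GeodesicConfinement

/-!
# Crux `AhHadamardFilling` — line `einstein-bulk-transfer`: helpers for the compactification
# collar (lead's stub `stub_compactificationCollar`)

Collar bookkeeping and the three analytic/topological helpers of the assembly of the lead's stub
(`Theorems/InformationMetricHadamardAhHadamardFillingStubCompactificationCollar.lean`):
`helper_coneEstimateOfGerm` (uniform cone estimate of a `C¹` collar germ, from the landed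
`stub_uniformCone`), `helper_isCompactComplPreimageImageCollar` (co-compactness of collar far
parts) and `helper_innerMfderivInteriorInverse` (the pullback identity `g(dP w, dP w) =
ḡ(dκ w, dκ w)/ρ²` through the interior chart).

Construction. `b = ⟨M, ι⟩` is a boundary datum of the compact `X̄`, `D` its open collar
(tree `BoundaryData.nonempty_openCollar`), `κ = uncurry D.toFun : M × [0,∞) → X̄`. At a boundary
point the normal pair `(z x, θ x)` (`dκ(z,θ) = √φ ν`) exists (pointwise stub) and is continuous
(continuity stub); `z = Σ cᵢ Yᵢ` in a finite frame (frame stub); the smoothing stub turns `θ` and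
the `cᵢ` into `C¹` families `λ U(x,λ)`, the base-motion stub integrates them to `F`, and
`Ψ = (F, λ U_θ) : M × ℝ → M × ℝ` is a `C¹` collar germ with `dΨ_{(x,0)}(v,s) = (v + s z, s θ)`;
the collar-germ stub makes it injective with open, band-swallowing images on `M × (0, l₁)`;
`Φ(x,λ) = j⁻¹ κ Ψ(x, l₁ λ)`. The metric identity `g(dΦ w, dΦ w) = ḡ(dκ dΨ w', ·)/ρ²` with
`ρ ∘ κ = t · r` (Hadamard-quotient stub) and the uniform cone stub give the asymptotics with
`c = 1`, `κ₀ = 1/l₁²`.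
-/

noncomputable section

-- the prescribed namespace `Summit.<P>.<Sub>.…` duplicates `SmoothPoincare4` (P = Sub)
set_option linter.dupNamespace false

open scoped Manifold ContDiff Topology
open Set Function Bundle
open Literature.Topology.FourManifolds Literature.Geometry.Lorentzian

namespace Summit.SmoothPoincare4.SmoothPoincare4.Cruxes.AhHadamardFilling.EinsteinBulkTransfer

/-! ## Collar bookkeeping (general boundary datum) -/

section Collar

variable {X : Type} [TopologicalSpace X] [ChartedSpace (EuclideanHalfSpace 5) X]
  {b : BoundaryData (𝓡∂ 5) X (𝓡 4)} (D : b.OpenCollar)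

/-- The open collar maps relatively open subsets of `∂X × [0,∞)` to open subsets of `X`
(it is a homeomorphism onto the open `region`, with inverse `(proj, height)`). [folklore] -/
theorem isOpen_image_toFun_inter {V : Set (b.carrier × ℝ)} (hV : IsOpen V) :
    IsOpen (uncurry D.toFun '' (V ∩ (univ : Set b.carrier) ×ˢ Ici (0 : ℝ))) := by
  have heq : uncurry D.toFun '' (V ∩ (univ : Set b.carrier) ×ˢ Ici (0 : ℝ)) =
      D.region ∩ D.projHeight ⁻¹' V := by
    ext w
    constructor
    · rintro ⟨⟨y, t⟩, ⟨hyV, -, ht⟩, rfl⟩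
      refine ⟨D.mem_region y t ht, ?_⟩
      show D.projHeight (D.toFun y t) ∈ V
      rwa [D.projHeight_apply_toFun y ht]
    · rintro ⟨hw, hwV⟩
      refine ⟨D.projHeight w, ⟨hwV, mem_univ _, D.height_nonneg w hw⟩, ?_⟩
      exact D.uncurry_toFun_projHeight hw
  rw [heq]
  exact D.continuousOn_projHeight.isOpen_inter_preimage D.isOpen_region hV

/-- The open collar is injective on `∂X × [0,∞)`. [folklore] -/
theorem injOn_uncurry_toFun : InjOn (uncurry D.toFun) ((univ : Set b.carrier) ×ˢ Ici (0 : ℝ)) := by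
  rintro ⟨y, t⟩ ⟨-, ht⟩ ⟨y', t'⟩ ⟨-, ht'⟩ h
  obtain ⟨h1, h2⟩ := D.eq_of_apply_eq (mem_Ici.1 ht) (mem_Ici.1 ht') h
  exact Prod.ext h1 h2


end Collar

/-- **Co-compactness of collar far parts.** Let `κ` be an open collar of the compact `X̄` along
`b`, `j : N → X̄` an embedding onto the interior, and `A ⊆ ∂X̄ × ℝ` a set with `κ '' A` open
containing a band `∂X̄ × (0, δ)`. Then the complement of `j ⁻¹' (κ '' A)` in `N` is compact: its
`j`-image is the complement of the open set `κ(∂X̄ × [0,δ)) ∪ κ(A) ⊇ ∂X̄`, closed in `X̄`. [folklore] -/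
theorem helper_isCompactComplPreimageImageCollar {X : Type} [TopologicalSpace X]
    [ChartedSpace (EuclideanHalfSpace 5) X] {b : BoundaryData (𝓡∂ 5) X (𝓡 4)} (D : b.OpenCollar)
    [CompactSpace X] {N : Type} [TopologicalSpace N] (j : N → X) (hj : Topology.IsEmbedding j) (hjr : range j = (𝓡∂ 5).interior X)
    {A : Set (b.carrier × ℝ)} (hAo : IsOpen (uncurry D.toFun '' A))
    {δ : ℝ} (hδ : 0 < δ) (hband : (univ : Set b.carrier) ×ˢ Ioo (0 : ℝ) δ ⊆ A) :
    IsCompact (j ⁻¹' (uncurry D.toFun '' A))ᶜ := by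
  have hopen2 : IsOpen (uncurry D.toFun ''
      ((univ : Set b.carrier) ×ˢ Iio δ ∩ (univ : Set b.carrier) ×ˢ Ici (0 : ℝ))) :=
    isOpen_image_toFun_inter D (isOpen_univ.prod isOpen_Iio)
  -- the complement of `j '' (complement)` in `X̄`
  have hcompl : (range j ∩ (uncurry D.toFun '' A)ᶜ)ᶜ =
      uncurry D.toFun '' ((univ : Set b.carrier) ×ˢ Iio δ ∩ (univ : Set b.carrier) ×ˢ Ici (0 : ℝ)) ∪
        uncurry D.toFun '' A := by
    rw [compl_inter, compl_compl, hjr, ModelWithCorners.compl_interior, ← b.range_incl]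
    apply Subset.antisymm
    · rintro w (⟨y, rfl⟩ | hw)
      · exact Or.inl ⟨(y, 0), ⟨⟨mem_univ _, mem_Iio.2 hδ⟩, mem_univ _, self_mem_Ici⟩, D.apply_zero y⟩
      · exact Or.inr hw
    · rintro w (⟨⟨y, μ⟩, ⟨⟨-, hμδ⟩, -, hμ0⟩, rfl⟩ | hw)
      · rcases (mem_Ici.1 hμ0).eq_or_lt with h | h
        · change (0 : ℝ) = μ at h
          subst h
          exact Or.inl ⟨y, (D.apply_zero y).symm⟩
        · exact Or.inr (mem_image_of_mem _ (hband ⟨mem_univ _, h, mem_Iio.1 hμδ⟩))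
      · exact Or.inr hw
  have hclosed : IsClosed (j '' (j ⁻¹' (uncurry D.toFun '' A))ᶜ) := by
    rw [← preimage_compl, image_preimage_eq_range_inter, ← isOpen_compl_iff, hcompl]
    exact hopen2.union hAo
  exact hj.isInducing.isCompact_iff.2 hclosed.isCompact


/-- A continuous bilinear form is quadratic on the diagonal: `B(a v, a v) = a² B(v, v)`. [folklore] -/
theorem bilin_apply_smul_smul {E : Type*} [AddCommGroup E] [Module ℝ E] [TopologicalSpace E]
    (B : E →L[ℝ] E →L[ℝ] ℝ) (a : ℝ) (v : E) : B (a • v) (a • v) = a ^ 2 * B v v := by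
  rw [map_smul, map_smul]
  simp only [FunLike.coe_smul, Pi.smul_apply, smul_eq_mul]
  ring

/-! ## The cone function of a collar germ: uniform estimate -/

/-- **Uniform cone estimate for a collar germ.** Let `κ = uncurry D.toFun` be an open collar of
`X̄` along the boundary datum `b`, `ḡ` a `C²` metric on `X̄`, `g₀` a smooth metric on `∂X̄`, and
`Ψ` a `C¹` self-map of `∂X̄ × ℝ` with `Ψ(x,0) = (x,0)`, height `(Ψ p).2 = p.2 · U p` (`U`
continuous, `U(x,0) = θ x > 0`) and `dΨ_{(x,0)}(v,s) = (v + s z, s θ)`, where `(z, θ)` satisfies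
the quadratic identity `ḡ(dκ(v + s z, s θ), ·) = (θ a₀)² (s² + g₀(v,v))`, `a₀ = r(x,0) > 0`, `r`
continuous. Then `Q_p(w) := ḡ(dκ_{Ψ p}(dΨ_p w), ·) / (U(p) r(Ψ p))²` is within `ε (s² + g₀(v,v))`
of `s² + g₀(v,v)` for `0 < λ < t(ε)`: `Q` is fibrewise quadratic, equals `s² + g₀(v,v)` on the
zero slice, and is continuous there from positive heights (continuity of `tangentMapWithin κ`,
`tangentMap Ψ`, and of `ḡ` on `TX̄`), so the landed `stub_uniformCone` applies. [folklore] -/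
theorem helper_coneEstimateOfGerm {X : Type} [TopologicalSpace X]
    [ChartedSpace (EuclideanHalfSpace 5) X] [IsManifold (𝓡∂ 5) ∞ X]
    {b : BoundaryData (𝓡∂ 5) X (𝓡 4)} [T2Space b.carrier] [SecondCountableTopology b.carrier]
    [CompactSpace b.carrier] (D : b.OpenCollar)
    (g₀ : Bundle.ContMDiffRiemannianMetric (𝓡 4) ∞ (EuclideanSpace ℝ (Fin 4))
      (TangentSpace (𝓡 4) : b.carrier → Type _))
    (gb : Bundle.ContMDiffRiemannianMetric (𝓡∂ 5) 2 (EuclideanSpace ℝ (Fin 5))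
      (TangentSpace (𝓡∂ 5) : X → Type _))
    (Ψ : b.carrier × ℝ → b.carrier × ℝ)
    (hΨ1 : ContMDiff ((𝓡 4).prod 𝓘(ℝ, ℝ)) ((𝓡 4).prod 𝓘(ℝ, ℝ)) 1 Ψ)
    (hΨ0 : ∀ x : b.carrier, Ψ (x, 0) = (x, 0))
    (U : b.carrier × ℝ → ℝ) (hUc : Continuous U) (hΨ2 : ∀ p : b.carrier × ℝ, (Ψ p).2 = p.2 * U p)
    (θ : b.carrier → ℝ) (hθ : ∀ x, 0 < θ x) (hU0 : ∀ x : b.carrier, U (x, 0) = θ x)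
    (z : (x : b.carrier) → TangentSpace (𝓡 4) x)
    (hΨd : ∀ (x : b.carrier) (v : TangentSpace (𝓡 4) x) (s : ℝ),
      mfderiv ((𝓡 4).prod 𝓘(ℝ, ℝ)) ((𝓡 4).prod 𝓘(ℝ, ℝ)) Ψ (x, 0) (v, s) = (v + s • z x, s * θ x))
    (r : b.carrier × ℝ → ℝ) (hrc : Continuous r) (hr0 : ∀ x : b.carrier, 0 < r (x, 0))
    (hzθ : ∀ (x : b.carrier) (v : TangentSpace (𝓡 4) x) (s : ℝ),
      gb.inner (uncurry D.toFun (x, 0))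
          (mfderivWithin ((𝓡 4).prod 𝓘(ℝ, ℝ)) (𝓡∂ 5) (uncurry D.toFun) (univ ×ˢ Ici 0) (x, 0)
            (v + s • z x, s * θ x))
          (mfderivWithin ((𝓡 4).prod 𝓘(ℝ, ℝ)) (𝓡∂ 5) (uncurry D.toFun) (univ ×ˢ Ici 0) (x, 0)
            (v + s • z x, s * θ x)) =
        (θ x * r (x, 0)) ^ 2 * (s ^ 2 + g₀.inner x v v)) :
    ∀ ε : ℝ, 0 < ε → ∃ t : ℝ, 0 < t ∧ ∀ (x : b.carrier) (l : ℝ), l ∈ Ioo (0 : ℝ) t →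
      ∀ (v : TangentSpace (𝓡 4) x) (s : ℝ),
        |gb.inner (uncurry D.toFun (Ψ (x, l)))
              (mfderivWithin ((𝓡 4).prod 𝓘(ℝ, ℝ)) (𝓡∂ 5) (uncurry D.toFun) (univ ×ˢ Ici 0)
                (Ψ (x, l)) (mfderiv ((𝓡 4).prod 𝓘(ℝ, ℝ)) ((𝓡 4).prod 𝓘(ℝ, ℝ)) Ψ (x, l) (v, s)))
              (mfderivWithin ((𝓡 4).prod 𝓘(ℝ, ℝ)) (𝓡∂ 5) (uncurry D.toFun) (univ ×ˢ Ici 0)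
                (Ψ (x, l)) (mfderiv ((𝓡 4).prod 𝓘(ℝ, ℝ)) ((𝓡 4).prod 𝓘(ℝ, ℝ)) Ψ (x, l) (v, s))) /
            (U (x, l) * r (Ψ (x, l))) ^ 2 -
          (s ^ 2 + g₀.inner x v v)| ≤ ε * (s ^ 2 + g₀.inner x v v) := by
  have hκS : ContMDiffOn ((𝓡 4).prod 𝓘(ℝ, ℝ)) (𝓡∂ 5) ∞ (uncurry D.toFun)
      ((univ : Set b.carrier) ×ˢ Ici (0 : ℝ)) := D.contMDiffOn_toFun
  have hSU : UniqueMDiffOn ((𝓡 4).prod 𝓘(ℝ, ℝ)) ((univ : Set b.carrier) ×ˢ Ici (0 : ℝ)) :=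
    uniqueMDiffOn_univ_prod_Ici (b := b)
  -- tangent maps and the quadratic function of `ḡ`
  obtain ⟨Tκ, hTκdef⟩ : ∃ Tκ : TangentBundle ((𝓡 4).prod 𝓘(ℝ, ℝ)) (b.carrier × ℝ) →
      TangentBundle (𝓡∂ 5) X, Tκ = tangentMapWithin ((𝓡 4).prod 𝓘(ℝ, ℝ)) (𝓡∂ 5)
        (uncurry D.toFun) ((univ : Set b.carrier) ×ˢ Ici (0 : ℝ)) := ⟨_, rfl⟩
  obtain ⟨TΨ, hTΨdef⟩ : ∃ TΨ : TangentBundle ((𝓡 4).prod 𝓘(ℝ, ℝ)) (b.carrier × ℝ) →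
      TangentBundle ((𝓡 4).prod 𝓘(ℝ, ℝ)) (b.carrier × ℝ),
        TΨ = tangentMap ((𝓡 4).prod 𝓘(ℝ, ℝ)) ((𝓡 4).prod 𝓘(ℝ, ℝ)) Ψ := ⟨_, rfl⟩
  obtain ⟨qb, hqbdef⟩ : ∃ qb : TangentBundle (𝓡∂ 5) X → ℝ,
      qb = fun ξ => gb.inner ξ.proj ξ.snd ξ.snd := ⟨_, rfl⟩
  have hqbc : Continuous qb :=
    hqbdef ▸ (PseudoRiemannianMetric.ofRiemannian gb).continuous_val_tangentBundle
  have hTΨc : Continuous TΨ := hTΨdef ▸ hΨ1.continuous_tangentMap le_rfl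
  have hTκc : ContinuousOn Tκ
      (Bundle.TotalSpace.proj ⁻¹' ((univ : Set b.carrier) ×ˢ Ici (0 : ℝ))) :=
    hTκdef ▸ hκS.continuousOn_tangentMapWithin (by exact_mod_cast le_top) hSU
  have hprojc : Continuous
      (fun q : TangentBundle ((𝓡 4).prod 𝓘(ℝ, ℝ)) (b.carrier × ℝ) => q.proj) :=
    FiberBundle.continuous_proj _ _
  have hTΨproj : ∀ q, (TΨ q).proj = Ψ q.proj := fun q => by rw [hTΨdef]; rfl
  -- the cone function
  obtain ⟨Q, hQdef⟩ : ∃ Q : (p : b.carrier × ℝ) → TangentSpace ((𝓡 4).prod 𝓘(ℝ, ℝ)) p → ℝ,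
      Q = fun p w => qb (Tκ (TΨ ⟨p, w⟩)) / (U p * r (Ψ p)) ^ 2 := ⟨_, rfl⟩
  have hQeq : ∀ (p : b.carrier × ℝ) (w : TangentSpace ((𝓡 4).prod 𝓘(ℝ, ℝ)) p), Q p w =
      gb.inner (uncurry D.toFun (Ψ p))
          (mfderivWithin ((𝓡 4).prod 𝓘(ℝ, ℝ)) (𝓡∂ 5) (uncurry D.toFun) (univ ×ˢ Ici 0)
            (Ψ p) (mfderiv ((𝓡 4).prod 𝓘(ℝ, ℝ)) ((𝓡 4).prod 𝓘(ℝ, ℝ)) Ψ p w))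
          (mfderivWithin ((𝓡 4).prod 𝓘(ℝ, ℝ)) (𝓡∂ 5) (uncurry D.toFun) (univ ×ˢ Ici 0)
            (Ψ p) (mfderiv ((𝓡 4).prod 𝓘(ℝ, ℝ)) ((𝓡 4).prod 𝓘(ℝ, ℝ)) Ψ p w)) /
        (U p * r (Ψ p)) ^ 2 := fun p w => by
    rw [hQdef, hqbdef, hTκdef, hTΨdef]; rfl
  -- (E1) fibrewise homogeneity
  have hhom : ∀ (p : b.carrier × ℝ) (w : TangentSpace ((𝓡 4).prod 𝓘(ℝ, ℝ)) p) (a : ℝ),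
      Q p (a • w) = a ^ 2 * Q p w := by
    intro p w a
    rw [hQeq, hQeq, map_smul, map_smul, bilin_apply_smul_smul, mul_div_assoc]
  -- (E2) the value on the zero slice
  have h0 : ∀ (x : b.carrier) (v : TangentSpace (𝓡 4) x) (s : ℝ),
      Q (x, 0) (v, s) = s ^ 2 + g₀.inner x v v := by
    intro x v s
    rw [hQeq, hΨd x v s, hΨ0 x, hU0]
    have hne : (θ x * r (x, 0)) ^ 2 ≠ 0 := pow_ne_zero 2 (mul_ne_zero (hθ x).ne' (hr0 x).ne')
    exact (div_eq_iff hne).2 ((hzθ x v s).trans (mul_comm _ _))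
  -- (E3) continuity at the zero slice, from positive heights
  have hcont : ∀ (x : b.carrier) (w : TangentSpace ((𝓡 4).prod 𝓘(ℝ, ℝ)) (x, (0 : ℝ))),
      ContinuousWithinAt
        (fun q : TangentBundle ((𝓡 4).prod 𝓘(ℝ, ℝ)) (b.carrier × ℝ) => Q q.proj q.snd)
        {q | 0 < q.proj.2} ⟨(x, 0), w⟩ := by
    intro x w
    have hfun : (fun q : TangentBundle ((𝓡 4).prod 𝓘(ℝ, ℝ)) (b.carrier × ℝ) => Q q.proj q.snd) =
        fun q => qb (Tκ (TΨ q)) / (U q.proj * r (Ψ q.proj)) ^ 2 := by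
      funext q; rw [hQdef]
    rw [hfun]
    refine ContinuousWithinAt.div ?_ ?_ ?_
    · -- numerator `qb ∘ Tκ ∘ TΨ`: near `q₀` within `{λ > 0}`, `TΨ` lands over `∂X̄ × [0,∞)`
      have hUpos : ∀ᶠ q in 𝓝 (⟨(x, 0), w⟩ : TangentBundle ((𝓡 4).prod 𝓘(ℝ, ℝ)) (b.carrier × ℝ)),
          0 < U (q : TangentBundle ((𝓡 4).prod 𝓘(ℝ, ℝ)) (b.carrier × ℝ)).proj := by
        have hca : ContinuousAt
            (fun q : TangentBundle ((𝓡 4).prod 𝓘(ℝ, ℝ)) (b.carrier × ℝ) => U q.proj)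
            ⟨(x, 0), w⟩ := (hUc.comp hprojc).continuousAt
        have hq₀U : 0 < U ((⟨(x, 0), w⟩ :
            TangentBundle ((𝓡 4).prod 𝓘(ℝ, ℝ)) (b.carrier × ℝ)).proj) := by
          show 0 < U (x, 0)
          rw [hU0]; exact hθ x
        exact hca.eventually (lt_mem_nhds hq₀U)
      have hin : TΨ ⟨(x, 0), w⟩ ∈
          Bundle.TotalSpace.proj ⁻¹' ((univ : Set b.carrier) ×ˢ Ici (0 : ℝ)) := by
        show (TΨ ⟨(x, 0), w⟩).proj ∈ (univ : Set b.carrier) ×ˢ Ici (0 : ℝ)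
        rw [hTΨproj, hΨ0]
        exact ⟨mem_univ _, self_mem_Ici⟩
      have hg : ContinuousWithinAt (fun ξ => qb (Tκ ξ))
          (Bundle.TotalSpace.proj ⁻¹' ((univ : Set b.carrier) ×ˢ Ici (0 : ℝ))) (TΨ ⟨(x, 0), w⟩) :=
        hqbc.continuousAt.comp_continuousWithinAt (hTκc _ hin)
      have key : ContinuousWithinAt (fun q => qb (Tκ (TΨ q)))
          ({q | 0 < q.proj.2} ∩
            {q : TangentBundle ((𝓡 4).prod 𝓘(ℝ, ℝ)) (b.carrier × ℝ) | 0 < U q.proj})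
          ⟨(x, 0), w⟩ := by
        refine hg.comp hTΨc.continuousWithinAt ?_
        rintro q ⟨hq1, hq2⟩
        show (TΨ q).proj ∈ (univ : Set b.carrier) ×ˢ Ici (0 : ℝ)
        rw [hTΨproj]
        refine ⟨mem_univ _, ?_⟩
        show 0 ≤ (Ψ q.proj).2
        rw [hΨ2]
        exact (mul_pos hq1 hq2).le
      exact (continuousWithinAt_inter' (mem_nhdsWithin_of_mem_nhds hUpos)).1 key
    · exact (((hUc.comp hprojc).mul (hrc.comp (hΨ1.continuous.comp hprojc))).pow 2).continuousWithinAt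
    · show (U (x, 0) * r (Ψ (x, 0))) ^ 2 ≠ 0
      rw [hU0, hΨ0]
      exact pow_ne_zero 2 (mul_ne_zero (hθ x).ne' (hr0 x).ne')
  -- the landed uniform cone estimate
  intro ε hε
  obtain ⟨t, ht, hQt⟩ := stub_uniformCone b.carrier g₀ Q hhom hcont h0 ε hε
  exact ⟨t, ht, fun x l hl v s => (hQeq (x, l) (v, s)) ▸ hQt x l hl v s⟩

/-! ## The pullback identity through the interior chart -/

/-- **Pullback identity through the interior chart.** If `j : N → X̄` is smooth with
`j^*ḡ = ρ² g`, `κ` is the open collar and `P` satisfies `j ∘ P = κ` on `∂X̄ × (0,∞)`, then at a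
point `y` there, for `P` differentiable at `y`, `g(dP w, dP w) = ḡ(dκ w, dκ w) / ρ(κ y)²`
(chain rule for `j ∘ P = κ` near `y`). [folklore] -/
theorem helper_innerMfderivInteriorInverse {X : Type} [TopologicalSpace X]
    [ChartedSpace (EuclideanHalfSpace 5) X] [IsManifold (𝓡∂ 5) ∞ X]
    {b : BoundaryData (𝓡∂ 5) X (𝓡 4)} (D : b.OpenCollar)
    {N : Type} [TopologicalSpace N] [ChartedSpace (EuclideanSpace ℝ (Fin 5)) N]
    [IsManifold (𝓡 5) ∞ N]
    (g : Bundle.ContMDiffRiemannianMetric (𝓡 5) ∞ (EuclideanSpace ℝ (Fin 5))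
      (TangentSpace (𝓡 5) : N → Type _))
    (gb : Bundle.ContMDiffRiemannianMetric (𝓡∂ 5) 2 (EuclideanSpace ℝ (Fin 5))
      (TangentSpace (𝓡∂ 5) : X → Type _))
    (j : N → X) (hj : ContMDiff (𝓡 5) (𝓡∂ 5) ∞ j) (ρ : X → ℝ)
    (hjg : ∀ (x : N) (v w : TangentSpace (𝓡 5) x),
      gb.inner (j x) (mfderiv (𝓡 5) (𝓡∂ 5) j x v) (mfderiv (𝓡 5) (𝓡∂ 5) j x w) =
        ρ (j x) ^ 2 * g.inner x v w)
    (P : b.carrier × ℝ → N)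
    (hjP : ∀ q ∈ (univ : Set b.carrier) ×ˢ Ioi (0 : ℝ), j (P q) = uncurry D.toFun q)
    {y : b.carrier × ℝ} (hy : y ∈ (univ : Set b.carrier) ×ˢ Ioi (0 : ℝ))
    (hρy : ρ (uncurry D.toFun y) ≠ 0)
    (hPd : MDifferentiableAt ((𝓡 4).prod 𝓘(ℝ, ℝ)) (𝓡 5) P y)
    (w : TangentSpace ((𝓡 4).prod 𝓘(ℝ, ℝ)) y) :
    g.inner (P y) (mfderiv ((𝓡 4).prod 𝓘(ℝ, ℝ)) (𝓡 5) P y w)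
        (mfderiv ((𝓡 4).prod 𝓘(ℝ, ℝ)) (𝓡 5) P y w) =
      gb.inner (uncurry D.toFun y)
          (mfderivWithin ((𝓡 4).prod 𝓘(ℝ, ℝ)) (𝓡∂ 5) (uncurry D.toFun) (univ ×ˢ Ici 0) y w)
          (mfderivWithin ((𝓡 4).prod 𝓘(ℝ, ℝ)) (𝓡∂ 5) (uncurry D.toFun) (univ ×ˢ Ici 0) y w) /
        ρ (uncurry D.toFun y) ^ 2 := by
  have hyS : (univ : Set b.carrier) ×ˢ Ioi (0 : ℝ) ∈ 𝓝 y :=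
    (isOpen_univ.prod isOpen_Ioi).mem_nhds hy
  have hyS' : (univ : Set b.carrier) ×ˢ Ici (0 : ℝ) ∈ 𝓝 y :=
    Filter.mem_of_superset hyS (prod_mono le_rfl Ioi_subset_Ici_self)
  have hdj : MDifferentiableAt (𝓡 5) (𝓡∂ 5) j (P y) := hj.mdifferentiableAt (by simp)
  have hjPev : (j ∘ P) =ᶠ[𝓝 y] uncurry D.toFun :=
    Filter.eventuallyEq_of_mem hyS fun q hq => hjP q hq
  have hdjP : mfderiv (𝓡 5) (𝓡∂ 5) j (P y) (mfderiv ((𝓡 4).prod 𝓘(ℝ, ℝ)) (𝓡 5) P y w) =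
      mfderivWithin ((𝓡 4).prod 𝓘(ℝ, ℝ)) (𝓡∂ 5) (uncurry D.toFun)
        ((univ : Set b.carrier) ×ˢ Ici (0 : ℝ)) y w := by
    rw [← ContinuousLinearMap.comp_apply, ← mfderiv_comp _ hdj hPd, hjPev.mfderiv_eq,
      mfderivWithin_of_mem_nhds hyS']
    rfl
  have hpk := hjg (P y) (mfderiv ((𝓡 4).prod 𝓘(ℝ, ℝ)) (𝓡 5) P y w)
    (mfderiv ((𝓡 4).prod 𝓘(ℝ, ℝ)) (𝓡 5) P y w)
  rw [hdjP, hjP y hy] at hpk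
  rw [eq_div_iff (pow_ne_zero 2 hρy), hpk, mul_comm]

end Summit.SmoothPoincare4.SmoothPoincare4.Cruxes.AhHadamardFilling.EinsteinBulkTransfer

end
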